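import Mathlib
import Summits.QuantumFields.BalabanUV.Beta.ThinLoopHolonomy
import Summits.QuantumFields.BalabanUV.Beta.CoarseCoerciveCovariantEnergy

/-!
# Beta / CovariantPlateauBlocks — THE GENERAL-U MODEL INSTANCE OF E-I3, PART 1 (transports): on the fibred block lattice
# (blocks `Y` × offsets `(Fin n)^ν`) × `Cp` with ANY gluing of the blocks and ANY orthogonal bond transporters `W`, the
# contour transports `R(x) = W(Γ_{corner,x})` along the B5 (1.7) trees of the blocks (b07's `hol … treeWord` BY NAME) are
# orthogonal, the owner's thin-loop holonomy `hol b y = W_b R(tgt b)ᵀ R(src b)` (an4 `CoarseCoerciveCovariantEnergy` p221805)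
# is an orthogonal conjugate of this unit's `thinLoop` (p222209), hence its defect `h b := ‖hol b − 1‖` (ℓ²-operator
# norm of the complexification) obeys the owner's `hhol` AND is ≤ `ν(n − 1)·α` on every in-block bond when the plaquettes
# of `W` inside the blocks are within `α` of `1` — the ONLY field input of `coarse_coercive_cov`, supplied
# (unit `b2b-balaban-beta-d4-p2`, GEN 6, MODEL crew; claim «E-I3-COV-MODEL» journal l.15376)

HONEST FRAMING: discharging `BetaPertH` makes Bałaban's UV stability UNCONDITIONAL — NOT the continuum limit, NOT the
Clay problem.  HONEST DEPENDENCY (verbatim): «continuum YM on T⁴ ⇐ BetaPertH ∧ nine spine estimates (0/9 proved);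
BetaPertH ⇐ (D1) ∧ (D4) ∧ CAP+tail; G-an2-4 gates asym, D1 and NE2/3/4.»  THIS MODULE DISCHARGES NOTHING of `BetaPertH`,
asserts NOTHING printed and cites nothing as a fact (ABSOLUTE RULE): [folklore] about a MODEL (cubic blocks, tree
contours, orthogonal fibre transporters as DATA; nothing of Bałaban's operators — his `U_k`, the averaged `Ū` of [B7], the
composite contours (3.15) — is instantiated; which `W` and which `α` ((3.35) + B7 (52)–(53)) is NODE O.2's business).
SHAPES located at [B9] = `Balaban1985BackgroundPropagators` (3.19) p. 393 («R(U(Γ^{(j)}_{y,x}))»), (3.35) p. 396; [B5] =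
`Balaban1984PropagatorsI` (1.7) p. 18.  No class change on row D4 or G-B9-15 (width 0; D4 DISCHARGE NO DATE); NOT
BetaPertH, NOT continuum, NOT Clay, NOT summit progress.

CONTENT (kernel, 0 sorry).  §1 the carrier: sites `Y × (Fin ν → Fin n)`, bonds `site × direction`, `bsrc`, `btgt σ`
(in-block successor, else the glued block `σ i y` at offset `0`), the embedding `emb` of offsets into `ℤ^ν` and its
inverse `toOff` on the box `[0, n−1]^ν`.  §2 the block's bond field READ ON `ℤ^ν` as orthogonal units (`oU`, `rawCfg`;
values in b07's `unitaryUnits`), the TREE TRANSPORTS `Rtr x := W(Γ_{0, emb x})` (`Rtr_mul_transpose`, `transpose_mul_Rtr`).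
§3 the owner's `hol` versus `thinLoop`: **`hol_eq_conj_thinLoop`** (in-block bonds), the defect `hdef b y :=
‖cpx(hol b y) − 1‖`, **`hhol_hdef`** (the owner's hypothesis `hhol` holds for it, every bond), **`hdef_le_of_plaquettes`**
(≤ `|emb v|₁·α ≤ ν(n−1)·α` on in-block bonds from the in-block plaquettes, via p222209's
`norm_thinLoop_sub_one_le_of_plaquettes`), the concrete in-block plaquette `plaqW` and `hol_rawCfg_plaqWord`.
Part 2 (`CovariantPlateauBlocksEnd`): the ν-dim in-block product plateaus, the counting, and the END by
`coarse_coercive_cov` BY NAME.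
-/

namespace Summit.QuantumFields.BalabanUV.Beta.CovariantPlateauBlocks

open scoped BigOperators Matrix Matrix.Norms.L2Operator
open Literature.MathematicalPhysics.QuantumFieldTheory.Balaban1983to89.B7Prop1Explicit
open Literature.MathematicalPhysics.QuantumFieldTheory.Balaban1983to89.B7Prop1Local (InBox PlaqIn hol_plaqWord_eq)
open Literature.MathematicalPhysics.QuantumFieldTheory.Balaban1983to89.B7Prop2Explicit (unitaryUnits mem_unitaryUnits
  hol_mem_of)
open Summit.QuantumFields.BalabanUV.Beta.ThinLoopHolonomy

noncomputable section

variable {Y : Type*} {Cp : Type*} [Fintype Cp] [DecidableEq Cp] {ν n : ℕ}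

/-! ## §1 The fibred block carrier -/

/-- In-block offsets `(Fin n)^ν`. [folklore] -/
abbrev Off (ν n : ℕ) : Type := Fin ν → Fin n

/-- Fine sites: block label × offset. [folklore] -/
abbrev BSite (Y : Type*) (ν n : ℕ) : Type _ := Y × Off ν n

/-- Bonds: a site and a direction (the bond from `x` to its successor in direction `i`). [folklore] -/
abbrev Bond (Y : Type*) (ν n : ℕ) : Type _ := BSite Y ν n × Fin ν

/-- The source of a bond. [folklore] -/
def bsrc (b : Bond Y ν n) : BSite Y ν n := b.1

/-- The in-block successor offset `v + e_i` (when `v i + 1 < n`). [folklore] -/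
def succOff (v : Off ν n) (i : Fin ν) (h : (v i : ℕ) + 1 < n) : Off ν n := Function.update v i ⟨v i + 1, h⟩

variable [NeZero n]

/-- The target of a bond: the in-block successor, or — across a block face — offset `0` in the glued block `σ i y`
(ANY gluing `σ`: a torus, a box with identifications, …). [folklore] -/
def btgt (σ : Fin ν → Y → Y) (b : Bond Y ν n) : BSite Y ν n :=
  if h : (b.1.2 b.2 : ℕ) + 1 < n then (b.1.1, succOff b.1.2 b.2 h)
  else (σ b.2 b.1.1, Function.update b.1.2 b.2 ⟨0, Nat.pos_of_ne_zero (NeZero.ne n)⟩)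

/-- The target of an IN-BLOCK bond (`v i + 1 < n`: the successor stays in the block). [folklore] -/
theorem btgt_of_inBlk (σ : Fin ν → Y → Y) {b : Bond Y ν n} (h : (b.1.2 b.2 : ℕ) + 1 < n) :
    btgt σ b = (b.1.1, succOff b.1.2 b.2 h) := by
  unfold btgt
  exact dif_pos h

omit [NeZero n] in
/-- The embedding of offsets into `ℤ^ν`. [folklore] -/
def emb (v : Off ν n) : Site ν := fun i => (v i : ℤ)

omit [NeZero n] in
/-- The upper corner `(n − 1, …, n − 1)` of the block read in `ℤ^ν` (lower corner `0`). [folklore] -/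
def boxHi (ν n : ℕ) : Site ν := fun _ => (n : ℤ) - 1

omit [NeZero n] in
/-- Offsets embed into the box `[0, n − 1]^ν`. [folklore] -/
theorem emb_inBox (v : Off ν n) : InBox 0 (boxHi ν n) (emb v) := fun i => by
  have := (v i).isLt
  simp only [emb, boxHi, Pi.zero_apply]
  omega

/-- The (total) inverse of `emb` — honest on the box. [folklore] -/
def toOff (z : Site ν) : Off ν n := fun i => ⟨(z i).toNat % n, Nat.mod_lt _ (Nat.pos_of_ne_zero (NeZero.ne n))⟩

/-- `toOff ∘ emb = id`. [folklore] -/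
theorem toOff_emb (v : Off ν n) : toOff (emb v) = v := by
  funext i
  apply Fin.ext
  simp only [toOff, emb, Int.toNat_natCast]
  exact Nat.mod_eq_of_lt (v i).isLt

/-- `emb ∘ toOff = id` on the box. [folklore] -/
theorem emb_toOff {z : Site ν} (hz : InBox 0 (boxHi ν n) z) : emb (toOff (n := n) z) = z := by
  funext i
  have h := hz i
  simp only [boxHi, Pi.zero_apply] at h
  simp only [emb, toOff]
  have h1 : ((z i).toNat : ℤ) = z i := Int.toNat_of_nonneg h.1
  have h2 : (z i).toNat < n := by omega
  rw [Nat.mod_eq_of_lt h2, h1]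

omit [NeZero n] in
/-- `emb (v + e_i) = emb v + e_i`. [folklore] -/
theorem emb_succOff (v : Off ν n) (i : Fin ν) (h : (v i : ℕ) + 1 < n) : emb (succOff v i h) = emb v + e i := by
  funext j
  simp only [emb, succOff, Pi.add_apply, e_apply]
  by_cases hj : j = i
  · subst hj; simp
  · simp [hj]

omit [NeZero n] in
/-- `|emb v|₁ ≤ ν·(n − 1)`. [folklore] -/
theorem l1_emb_le (v : Off ν n) : (l1 (emb v) : ℝ) ≤ ν * ((n : ℝ) - 1) := by
  have h : ∀ i, ((emb v i).natAbs : ℝ) ≤ (n : ℝ) - 1 := fun i => by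
    have h1 := (v i).isLt
    have h2 : (emb v i).natAbs = (v i : ℕ) := by simp [emb]
    rw [h2]
    have : ((v i : ℕ) : ℝ) + 1 ≤ n := by exact_mod_cast h1
    linarith
  calc (l1 (emb v) : ℝ) = ∑ i, ((emb v i).natAbs : ℝ) := by simp [l1]
    _ ≤ ∑ _i : Fin ν, ((n : ℝ) - 1) := Finset.sum_le_sum fun i _ => h i
    _ = ν * ((n : ℝ) - 1) := by rw [Finset.sum_const, Finset.card_univ, Fintype.card_fin, nsmul_eq_mul]

/-! ## §2 The block's bond field read on `ℤ^ν`; the tree transports -/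

/-- An orthogonal matrix `O` (`Oᵀ·O = 1`) as a unit with inverse `Oᵀ`. [folklore] -/
def oU (O : Matrix Cp Cp ℝ) (hO : Oᵀ * O = 1) : (Matrix Cp Cp ℝ)ˣ := ⟨O, Oᵀ, mul_eq_one_comm.mp hO, hO⟩

omit [NeZero n] in
/-- Orthogonal units are unitary units of the real matrix ring (star = transpose). [folklore] -/
theorem oU_mem (O : Matrix Cp Cp ℝ) (hO : Oᵀ * O = 1) : oU O hO ∈ unitaryUnits (Matrix Cp Cp ℝ) := by
  rw [mem_unitaryUnits, Unitary.mem_iff]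
  simp only [oU, Matrix.star_eq_conjTranspose, Matrix.conjTranspose_eq_transpose_of_trivial]
  exact ⟨hO, mul_eq_one_comm.mp hO⟩

omit [NeZero n] in
/-- For a unitary unit of the real matrix ring, `u⁻¹ = uᵀ` and `u·uᵀ = uᵀ·u = 1`. [folklore] -/
theorem val_inv_eq_transpose {u : (Matrix Cp Cp ℝ)ˣ} (hu : u ∈ unitaryUnits (Matrix Cp Cp ℝ)) :
    ((u⁻¹ : (Matrix Cp Cp ℝ)ˣ) : Matrix Cp Cp ℝ) = (u : Matrix Cp Cp ℝ)ᵀ := by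
  have h := Unitary.star_mul_self_of_mem (mem_unitaryUnits.mp hu)
  rw [Matrix.star_eq_conjTranspose, Matrix.conjTranspose_eq_transpose_of_trivial] at h
  exact Units.inv_eq_of_mul_eq_one_left h

omit [NeZero n] in
/-- `uᵀ·u = 1` for unitary units. [folklore] -/
theorem transpose_mul_of_mem {u : (Matrix Cp Cp ℝ)ˣ} (hu : u ∈ unitaryUnits (Matrix Cp Cp ℝ)) :
    (u : Matrix Cp Cp ℝ)ᵀ * (u : Matrix Cp Cp ℝ) = 1 := by
  rw [← val_inv_eq_transpose hu, ← Units.val_mul, inv_mul_cancel, Units.val_one]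

omit [NeZero n] in
/-- `u·uᵀ = 1` for unitary units. [folklore] -/
theorem mul_transpose_of_mem {u : (Matrix Cp Cp ℝ)ˣ} (hu : u ∈ unitaryUnits (Matrix Cp Cp ℝ)) :
    (u : Matrix Cp Cp ℝ) * (u : Matrix Cp Cp ℝ)ᵀ = 1 := by
  rw [← val_inv_eq_transpose hu, ← Units.val_mul, mul_inv_cancel, Units.val_one]

variable (W : Bond Y ν n → Matrix Cp Cp ℝ) (hW : ∀ b, (W b)ᵀ * W b = 1)

/-- THE BLOCK'S BOND FIELD READ ON `ℤ^ν`: at `z ∈ ℤ^ν`, direction `i`, the transporter of the bond from offset `toOff z` of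
block `y` — honest on the genuine bonds of the box (the only ones the tree contours and in-block plaquettes use; b07's
locality `thinLoop_congr` ∕ `PlaqIn`). [cite: Balaban1985BackgroundPropagators, (3.19) p.393] -/
def rawCfg (y : Y) : Site ν → Fin ν → (Matrix Cp Cp ℝ)ˣ := fun z i => oU (W ((y, toOff z), i)) (hW _)

/-- Its values are unitary units. [folklore] -/
theorem rawCfg_mem (y : Y) (z : Site ν) (i : Fin ν) : rawCfg W hW y z i ∈ unitaryUnits (Matrix Cp Cp ℝ) := oU_mem _ _

/-- **THE TREE TRANSPORT** `R(x) = W(Γ_{corner, x})` of the site `x = (y, v)` to the corner of its block along the B5 (1.7)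
tree contour (MODEL of `R(U(Γ_{y,x}))` in (3.19); b07's `hol … (treeWord …)`). [cite: Balaban1985BackgroundPropagators, (3.19) p.393] -/
def Rtr (x : BSite Y ν n) : Matrix Cp Cp ℝ :=
  ((hol (rawCfg W hW x.1) 0 (treeWord (emb x.2)) : (Matrix Cp Cp ℝ)ˣ) : Matrix Cp Cp ℝ)

/-- The tree transport is a unitary unit. [folklore] -/
theorem hol_rawCfg_mem (y : Y) (z : Site ν) (w : List (Letter ν)) :
    hol (rawCfg W hW y) z w ∈ unitaryUnits (Matrix Cp Cp ℝ) := hol_mem_of (rawCfg_mem W hW y) z w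

/-- `R(x)·R(x)ᵀ = 1` (the owner's hypothesis `hR`). [folklore] -/
theorem Rtr_mul_transpose (x : BSite Y ν n) : Rtr W hW x * (Rtr W hW x)ᵀ = 1 :=
  mul_transpose_of_mem (hol_rawCfg_mem W hW _ _ _)

/-- `R(x)ᵀ·R(x) = 1`. [folklore] -/
theorem transpose_mul_Rtr (x : BSite Y ν n) : (Rtr W hW x)ᵀ * Rtr W hW x = 1 :=
  transpose_mul_of_mem (hol_rawCfg_mem W hW _ _ _)

/-! ## §3 The owner's thin-loop holonomy versus `thinLoop`; the defect `h` and its bound from the in-block plaquettes -/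

/-- The transport family of the covariant block averages∕bumps: `R y x := R(x)` (the tree transport of `x` inside ITS
block — the profile `t_y` vanishes off block `y`, so only `x ∈ B(y)` matters). [folklore] -/
def Rfam : Y → BSite Y ν n → Matrix Cp Cp ℝ := fun _ x => Rtr W hW x

/-- **THE OWNER'S HOLONOMY IS A CONJUGATE OF THE THIN LOOP**: for an in-block bond `b = ((y₀,v), i)`,
`hol b y = W_b·R(tgt b)ᵀ·R(src b) = R(src b)ᵀ · [R(src b)·W_b·R(tgt b)ᵀ] · R(src b)` and the bracket is the value of
`thinLoop (rawCfg y₀) 0 (emb v) i` (b07's axial-gauge bond variable). [folklore] -/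
theorem hol_eq_conj_thinLoop (σ : Fin ν → Y → Y) {b : Bond Y ν n} (hb : (b.1.2 b.2 : ℕ) + 1 < n) (y : Y) :
    CoarseCoerciveCovariantEnergy.hol bsrc (btgt σ) W (Rfam W hW) b y =
      (Rtr W hW b.1)ᵀ * ((thinLoop (rawCfg W hW b.1.1) 0 (emb b.1.2) b.2 : (Matrix Cp Cp ℝ)ˣ) : Matrix Cp Cp ℝ) *
        Rtr W hW b.1 := by
  have htgt := btgt_of_inBlk σ hb
  have hval : ((thinLoop (rawCfg W hW b.1.1) 0 (emb b.1.2) b.2 : (Matrix Cp Cp ℝ)ˣ) : Matrix Cp Cp ℝ) =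
      Rtr W hW b.1 * W b * (Rtr W hW (btgt σ b))ᵀ := by
    rw [thinLoop_eq, Units.val_mul, Units.val_mul, val_inv_eq_transpose (hol_rawCfg_mem W hW _ _ _), sub_zero,
      ← emb_succOff b.1.2 b.2 hb, sub_zero, htgt]
    simp only [Rtr, rawCfg, toOff_emb, oU]
  rw [hval, CoarseCoerciveCovariantEnergy.hol]
  simp only [Rfam, bsrc]
  rw [show (Rtr W hW b.1)ᵀ * (Rtr W hW b.1 * W b * (Rtr W hW (btgt σ b))ᵀ) * Rtr W hW b.1
      = ((Rtr W hW b.1)ᵀ * Rtr W hW b.1) * W b * (Rtr W hW (btgt σ b))ᵀ * Rtr W hW b.1 by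
        simp only [Matrix.mul_assoc], transpose_mul_Rtr, Matrix.one_mul]

/-- **THE DEFECT** supplied to the owner's engine: `h b y := ‖cpx(hol b y) − 1‖`, the `ℓ²`-operator norm of the
complexified holonomy defect (independent of `y`). [folklore] -/
def hdef (σ : Fin ν → Y → Y) (b : Bond Y ν n) (y : Y) : ℝ :=
  ‖cpxHom (CoarseCoerciveCovariantEnergy.hol bsrc (btgt σ) W (Rfam W hW) b y) - 1‖

/-- `h ≥ 0`. [folklore] -/
theorem hdef_nonneg (σ : Fin ν → Y → Y) (b : Bond Y ν n) (y : Y) : 0 ≤ hdef W hW σ b y := norm_nonneg _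

/-- **THE OWNER'S HYPOTHESIS `hhol` HOLDS FOR `h`** (every bond, every block): `‖cpx(hol b y − 1)·v‖ ≤ h b y·‖v‖`.
[folklore] -/
theorem hhol_hdef (σ : Fin ν → Y → Y) (b : Bond Y ν n) (y : Y) (v : Cp → ℂ) :
    CoarseCoerciveCovariantEnergy.l2
        (CoarseCoerciveCovariantEnergy.cpx (CoarseCoerciveCovariantEnergy.hol bsrc (btgt σ) W (Rfam W hW) b y - 1) *ᵥ v) ≤
      hdef W hW σ b y * CoarseCoerciveCovariantEnergy.l2 v := by
  have hc : CoarseCoerciveCovariantEnergy.cpx (CoarseCoerciveCovariantEnergy.hol bsrc (btgt σ) W (Rfam W hW) b y - 1) =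
      cpxHom (CoarseCoerciveCovariantEnergy.hol bsrc (btgt σ) W (Rfam W hW) b y) - 1 := by
    rw [CoarseCoerciveCovariantEnergy.cpx, map_sub, map_one]
  rw [hc]
  exact norm_toLp_mulVec_le _ v

/-- The complexified configuration (values in the norm-≤-1 units of `Matrix Cp Cp ℂ`). [folklore] -/
def cpxCfg (y : Y) : Site ν → Fin ν → (Matrix Cp Cp ℂ)ˣ :=
  fun z i => Units.map (cpxHom (Cp := Cp) : Matrix Cp Cp ℝ →* Matrix Cp Cp ℂ) (rawCfg W hW y z i)

/-- Its values are norm-≤-1 units. [folklore] -/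
theorem cpxCfg_mem [Nonempty Cp] (y : Y) (z : Site ν) (i : Fin ν) : cpxCfg W hW y z i ∈ U1 (Matrix Cp Cp ℂ) := by
  have h : cpxCfg W hW y z i = cpxUnit (W ((y, toOff z), i)) (hW _) := Units.ext rfl
  rw [h]
  exact cpxUnit_mem_U1 _ _

/-- Pushing the thin loop through the complexification. [folklore] -/
theorem val_thinLoop_cpxCfg (y : Y) (x : Site ν) (μ : Fin ν) :
    ((thinLoop (cpxCfg W hW y) 0 x μ : (Matrix Cp Cp ℂ)ˣ) : Matrix Cp Cp ℂ) =
      cpxHom ((thinLoop (rawCfg W hW y) 0 x μ : (Matrix Cp Cp ℝ)ˣ) : Matrix Cp Cp ℝ) :=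
  congrArg Units.val (thinLoop_map (Units.map (cpxHom (Cp := Cp) : Matrix Cp Cp ℝ →* Matrix Cp Cp ℂ))
    (rawCfg W hW y) 0 x μ)

/-- Pushing plaquettes through the complexification. [folklore] -/
theorem val_hol_cpxCfg (y : Y) (z : Site ν) (w : List (Letter ν)) :
    ((hol (cpxCfg W hW y) z w : (Matrix Cp Cp ℂ)ˣ) : Matrix Cp Cp ℂ) =
      cpxHom ((hol (rawCfg W hW y) z w : (Matrix Cp Cp ℝ)ˣ) : Matrix Cp Cp ℝ) :=
  congrArg Units.val (hol_map (Units.map (cpxHom (Cp := Cp) : Matrix Cp Cp ℝ →* Matrix Cp Cp ℂ))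
    (rawCfg W hW y) z w)

/-- **THE DEFECT IS AT MOST THE THIN-LOOP DEFECT** (orthogonal conjugation does not increase the operator norm):
`h b y ≤ ‖cpx(thin loop) − 1‖` on in-block bonds. [folklore] -/
theorem hdef_le_norm_thinLoop (σ : Fin ν → Y → Y) {b : Bond Y ν n} (hb : (b.1.2 b.2 : ℕ) + 1 < n) (y : Y) :
    hdef W hW σ b y ≤ ‖((thinLoop (cpxCfg W hW b.1.1) 0 (emb b.1.2) b.2 : (Matrix Cp Cp ℂ)ˣ) : Matrix Cp Cp ℂ) - 1‖ := by
  set T := ((thinLoop (rawCfg W hW b.1.1) 0 (emb b.1.2) b.2 : (Matrix Cp Cp ℝ)ˣ) : Matrix Cp Cp ℝ) with hT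
  set C := cpxHom (Rtr W hW b.1) with hC
  have hRt : (Rtr W hW b.1)ᵀ * Rtr W hW b.1 = 1 := transpose_mul_Rtr W hW b.1
  have hid : cpxHom ((Rtr W hW b.1)ᵀ * T * Rtr W hW b.1) - 1 = cpxHom (Rtr W hW b.1)ᵀ * (cpxHom T - 1) * C := by
    rw [mul_sub, sub_mul, mul_one, ← map_mul, ← map_mul, ← map_mul, hRt, map_one]
  rw [hdef, hol_eq_conj_thinLoop W hW σ hb, val_thinLoop_cpxCfg, hid]
  have h1 : ‖cpxHom (Rtr W hW b.1)ᵀ‖ ≤ 1 :=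
    norm_cpxHom_le_one _ (by rw [Matrix.transpose_transpose]; exact Rtr_mul_transpose W hW b.1)
  have h2 : ‖C‖ ≤ 1 := norm_cpxHom_le_one _ hRt
  calc ‖cpxHom (Rtr W hW b.1)ᵀ * (cpxHom T - 1) * C‖ ≤ ‖cpxHom (Rtr W hW b.1)ᵀ‖ * ‖cpxHom T - 1‖ * ‖C‖ :=
        (norm_mul_le _ _).trans (mul_le_mul_of_nonneg_right (norm_mul_le _ _) (norm_nonneg _))
    _ ≤ 1 * ‖cpxHom T - 1‖ * 1 := by gcongr
    _ = ‖cpxHom T - 1‖ := by ring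

/-- **THE FIELD INPUT SUPPLIED (plaquette form)**: if every plaquette of `W` INSIDE the block (read on `ℤ^ν`) is within
`α` of `1` in the `ℓ²`-operator norm of its complexification, then the defect of every IN-BLOCK bond `b = ((y₀, v), i)`
is at most `|v|₁·α ≤ ν(n − 1)·α` — b07's non-abelian Stokes ladder through p222209. [cite: Balaban1985BackgroundPropagators, (3.35) p.396] -/
theorem hdef_le_of_plaquettes [Nonempty Cp] (σ : Fin ν → Y → Y) {α : ℝ} (hα : 0 ≤ α)
    (hplaq : ∀ (y : Y) (z : Site ν) (κ μ : Fin ν), κ ≠ μ → PlaqIn 0 (boxHi ν n) (z, κ, μ) →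
      ‖cpxHom ((hol (rawCfg W hW y) z (plaqWord κ μ) : (Matrix Cp Cp ℝ)ˣ) : Matrix Cp Cp ℝ) - 1‖ ≤ α)
    {b : Bond Y ν n} (hb : (b.1.2 b.2 : ℕ) + 1 < n) (y : Y) :
    hdef W hW σ b y ≤ ν * ((n : ℝ) - 1) * α := by
  have hn1 : ∀ i, (0 : Site ν) i ≤ boxHi ν n i := fun i => by
    have := Nat.pos_of_ne_zero (NeZero.ne n)
    simp only [boxHi, Pi.zero_apply]; omega
  have hP := norm_thinLoop_sub_one_le_of_plaquettes hn1 (cpxCfg W hW b.1.1) (cpxCfg_mem W hW b.1.1) hα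
    (fun z κ μ hκμ hz => by rw [val_hol_cpxCfg]; exact hplaq b.1.1 z κ μ hκμ hz)
    (y := 0) (x := emb b.1.2) (μ := b.2) (fun i => ⟨le_rfl, hn1 i⟩) (emb_inBox _)
    (by rw [← emb_succOff b.1.2 b.2 hb]; exact emb_inBox _)
  rw [sub_zero] at hP
  calc hdef W hW σ b y ≤ _ := hdef_le_norm_thinLoop W hW σ hb y
    _ ≤ l1 (emb b.1.2) * α := hP
    _ ≤ ν * ((n : ℝ) - 1) * α := mul_le_mul_of_nonneg_right (l1_emb_le _) hα

/-- A crude bound valid for EVERY bond: `h ≤ 2` (both `cpx(hol)` and `1` have norm ≤ 1). [folklore] -/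
theorem hdef_le_two (σ : Fin ν → Y → Y) (b : Bond Y ν n) (y : Y) : hdef W hW σ b y ≤ 2 := by
  have h1 : ‖(1 : Matrix Cp Cp ℂ)‖ ≤ 1 := by
    rw [Matrix.cstar_norm_def, map_one]
    exact ContinuousLinearMap.norm_id_le
  have hhol : ‖cpxHom (CoarseCoerciveCovariantEnergy.hol bsrc (btgt σ) W (Rfam W hW) b y)‖ ≤ 1 := by
    refine norm_cpxHom_le_one _ ?_
    rw [CoarseCoerciveCovariantEnergy.hol, Matrix.transpose_mul, Matrix.transpose_mul, Matrix.transpose_transpose]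
    simp only [Rfam]
    have hs := Rtr_mul_transpose W hW (bsrc b)
    have ht := transpose_mul_Rtr W hW (btgt σ b)
    have hw := hW b
    calc (Rtr W hW (bsrc b))ᵀ * (Rtr W hW (btgt σ b) * (W b)ᵀ) * (W b * (Rtr W hW (btgt σ b))ᵀ * Rtr W hW (bsrc b))
        = (Rtr W hW (bsrc b))ᵀ * (Rtr W hW (btgt σ b) * ((W b)ᵀ * W b) * (Rtr W hW (btgt σ b))ᵀ) * Rtr W hW (bsrc b) := by
          simp only [Matrix.mul_assoc]
      _ = 1 := by
          rw [hw, Matrix.mul_one, Rtr_mul_transpose, Matrix.mul_one, transpose_mul_Rtr]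
  calc hdef W hW σ b y ≤ ‖cpxHom (CoarseCoerciveCovariantEnergy.hol bsrc (btgt σ) W (Rfam W hW) b y)‖ + ‖(1 : Matrix Cp Cp ℂ)‖ :=
        norm_sub_le _ _
    _ ≤ 1 + 1 := add_le_add hhol h1
    _ = 2 := by norm_num

/-- THE CONCRETE IN-BLOCK PLAQUETTE of `W` at offset `v` of block `y` in the directions `κ ≠ μ` (both successors inside the
block): `W(x,κ)·W(x+e_κ,μ)·W(x+e_μ,κ)ᵀ·W(x,μ)ᵀ`. [cite: Balaban1985Averaging, (44) p.24] -/
def plaqW (y : Y) (v : Off ν n) (κ μ : Fin ν) (hκ : (v κ : ℕ) + 1 < n) (hμ : (v μ : ℕ) + 1 < n) : Matrix Cp Cp ℝ :=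
  W ((y, v), κ) * W ((y, succOff v κ hκ), μ) * (W ((y, succOff v μ hμ), κ))ᵀ * (W ((y, v), μ))ᵀ

/-- On the box, b07's plaquette holonomy of `rawCfg` IS the concrete plaquette `plaqW`. [folklore] -/
theorem hol_rawCfg_plaqWord (y : Y) (v : Off ν n) {κ μ : Fin ν} (hκ : (v κ : ℕ) + 1 < n) (hμ : (v μ : ℕ) + 1 < n) :
    ((hol (rawCfg W hW y) (emb v) (plaqWord κ μ) : (Matrix Cp Cp ℝ)ˣ) : Matrix Cp Cp ℝ) = plaqW W y v κ μ hκ hμ := by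
  rw [hol_plaqWord_eq, Units.val_mul, Units.val_mul, Units.val_mul,
    val_inv_eq_transpose (rawCfg_mem W hW _ _ _), val_inv_eq_transpose (rawCfg_mem W hW _ _ _),
    ← emb_succOff v κ hκ, ← emb_succOff v μ hμ]
  simp only [rawCfg, toOff_emb, oU, plaqW]

/-- A plaquette `(z, κ, μ)` lying in the box has `z = emb v` with both successors inside the block. [folklore] -/
theorem exists_off_of_plaqIn {z : Site ν} {κ μ : Fin ν} (h : PlaqIn 0 (boxHi ν n) (z, κ, μ)) :
    ∃ v : Off ν n, emb v = z ∧ (v κ : ℕ) + 1 < n ∧ (v μ : ℕ) + 1 < n := by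
  obtain ⟨h1, h2⟩ := h
  refine ⟨toOff z, emb_toOff h1, ?_, ?_⟩
  · have hk := (h2 κ).2
    have hz := (h1 κ).1
    simp only [boxHi, Pi.add_apply, e_apply, if_true, Pi.zero_apply] at hk hz
    simp only [toOff]
    have : (z κ).toNat < n - 1 := by
      by_cases hκμ : κ = μ
      · subst hκμ; simp at hk; omega
      · rw [if_neg hκμ] at hk; omega
    have hn := Nat.pos_of_ne_zero (NeZero.ne n)
    rw [Nat.mod_eq_of_lt (by omega)]
    omega
  · have hk := (h2 μ).2
    have hz := (h1 μ).1
    simp only [boxHi, Pi.add_apply, e_apply, if_true, Pi.zero_apply] at hk hz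
    simp only [toOff]
    have : (z μ).toNat < n - 1 := by
      by_cases hκμ : μ = κ
      · subst hκμ; simp at hk; omega
      · rw [if_neg hκμ] at hk; omega
    have hn := Nat.pos_of_ne_zero (NeZero.ne n)
    rw [Nat.mod_eq_of_lt (by omega)]
    omega

/-- **THE FIELD INPUT, CONCRETE FORM**: «every plaquette of `W` inside every block is within `α` of `1`» (ℓ²-operator norm
of the complexification) ⟹ `h ≤ ν(n − 1)·α` on in-block bonds. [cite: Balaban1985BackgroundPropagators, (3.35) p.396] -/
theorem hdef_le_of_plaqW [Nonempty Cp] (σ : Fin ν → Y → Y) {α : ℝ} (hα : 0 ≤ α)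
    (hplaqW : ∀ (y : Y) (v : Off ν n) (κ μ : Fin ν) (hκ : (v κ : ℕ) + 1 < n) (hμ : (v μ : ℕ) + 1 < n), κ ≠ μ →
      ‖cpxHom (plaqW W y v κ μ hκ hμ) - 1‖ ≤ α)
    {b : Bond Y ν n} (hb : (b.1.2 b.2 : ℕ) + 1 < n) (y : Y) :
    hdef W hW σ b y ≤ ν * ((n : ℝ) - 1) * α := by
  refine hdef_le_of_plaquettes W hW σ hα (fun y' z κ μ hκμ hz => ?_) hb y
  obtain ⟨v, rfl, hκ, hμ⟩ := exists_off_of_plaqIn hz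
  rw [hol_rawCfg_plaqWord W hW y' v hκ hμ]
  exact hplaqW y' v κ μ hκ hμ hκμ

end

end Summit.QuantumFields.BalabanUV.Beta.CovariantPlateauBlocks
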